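import Literature.NumberTheory.EllipticCurves.EisensteinNewformLevelRaisingDeligneSerreLiftProofs
import Literature.NumberTheory.EllipticCurves.EigenformPrimeLevelNewformProofs
import Literature.NumberTheory.EllipticCurves.Gamma1PStabilisationProofs
import Literature.NumberTheory.EllipticCurves.HeckeEigenvectorModPOfCongruence
import Literature.NumberTheory.EllipticCurves.CuspFormsGamma1EisensteinDivision
import Literature.NumberTheory.EllipticCurves.EisensteinCongruence
import HarnessLib

/-!
# A `p`-ordinary newform of weight `≥ 2` congruent to the `p`-stabilisation of a weight-one
# eigenform (Deligne–Serre 6.9–6.11 with `U_p` in the Hecke family; proofs only)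

Topic `Literature/NumberTheory/EllipticCurves`; namespace
`Literature.NumberTheory.EllipticCurves.ModularForms` (helpers in `WeightOneOrdinaryLift`).
THEOREMS ONLY (no definition, no named fact; D-0026).

**Statement** (`exists_ordinary_newform_congr_of_weight_one`).  Let `p` be a prime,
`ι : ℚ̄_p ≃ ℂ`, and let `f ∈ S_1(N, χ)` (`p ∤ N`) be a normalised (`a_1 = 1`) eigenvector of the
Hecke operators `T_q`, `q ∤ N` prime (`T_q f = a_q f`, so in particular of `T_p`), whose Fourier
coefficients are `p`-integral through `ι⁻¹`; let `α + β = a_p`, `α β = χ(p)` with `ι⁻¹ α` a `p`-adic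
UNIT and `ι⁻¹ β` `p`-integral.  Then there are a weight `k ≥ 2` with `(p - 1) ∣ (k - 1)`, a level
`L₀ ∣ Np` and a NEWFORM `g₀ ∈ S_k(Γ₁(L₀))` such that

* `ι⁻¹ a_p(g₀) ≡ ι⁻¹ α (mod 𝔪)` — so `g₀` is `p`-ORDINARY through `ι⁻¹` (`‖ι⁻¹ a_p(g₀)‖ = 1`);
* `ι⁻¹ a_q(g₀) ≡ ι⁻¹ a_q (mod 𝔪)` for every prime `q ∤ Np`;
* `ι⁻¹ (ε_{g₀}(q) q^{k-1}) ≡ ι⁻¹ χ(q) (mod 𝔪)` for every prime `q ∤ Np`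

(`𝔪` the maximal ideal of `𝒪_{ℚ̄_p}`, i.e. `‖·‖ < 1`).  With the Galois representations attached to
`f` and `g₀` this says `ρ̄_{g₀} ≅ ρ̄_f` with `g₀` ordinary at `p` of weight `≥ 2`: the classical
substitute (Deligne–Serre 1974, 6.9–6.11; Wiles, Invent. Math. 94 (1988), §1 for the ordinary
refinement) for the `Λ`-adic argument "insert the `p`-stabilised `f` in an ordinary family and
specialise in weight `k ≥ 2`" (Wiles 1988, Thm. 3) as used by Allen, Compos. Math. 150 (2014),
proof of Lemma 87 (p. 70), in the case where `f` has level prime to `p`.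

**Proof.**
1. (`Gamma1PStabilisationProofs`) `F = f(τ) - β f(pτ) ∈ S_1(Np, χ')` has `U_p F = α F`,
   `T_q F = a_q F` (`q ∤ Np`), `a_n(F) = a_n(f) - β 𝟙_{p∣n} a_{n/p}(f)` (`p`-integral, `a_1 = 1`).
2. (Deligne–Serre 6.9, `eisenstein_qExpansion_congr_one`) `E_w ≡ 1 (mod p)` for an even `w ≥ 4`
   divisible by `p - 1`; `G = F E_w ∈ S_{1+w}(Np, χ')` has `a_n(G) ≡ a_n(F) (mod 𝔪)`, hence is an
   eigenvector MODULO `𝔪` of the `T_q` (`q ∤ Np`; the weight enters only through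
   `q^{w} ≡ 1 (mod p)`, Fermat) and of `U_p` (eigenvalue `≡ α`, a unit), with `a_1(G) ≡ 1`.
3. (Deligne–Serre 6.10–6.11, `DeligneSerreLift.exists_eigenform_of_congruence_nebentypus_congr`,
   the tree's lifting lemma over `𝒪_{ℚ̄_p}` with the diamond operators in the family) a genuine
   eigenform `g' ∈ S_{1+w}(Γ₁(Np))` of the `T_q`, of `U_p` and of the `⟨d⟩`, with congruent
   eigenvalues; its `U_p`-eigenvalue `μ` is `≡ α`, a unit.
4. (`EigenformPrimeLevelNewformProofs`) the newform `g₀` behind `g'` has level `L₀ ∣ Np` and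
   `a_p(g₀) = μ` if `p ∣ L₀`, `μ² - a_p(g₀) μ + ε(p) p^{w} = 0` if `p ∤ L₀`; in both cases
   `a_p(g₀) ≡ μ ≡ α (mod 𝔪)` since `w ≥ 1`.

## References

* P. Deligne, J.-P. Serre, *Formes modulaires de poids 1*, Ann. Sci. ÉNS (4) 7 (1974), 6.9–6.11.
  [DeligneSerreASENS1974]
* A. Wiles, *On ordinary `λ`-adic representations associated to modular forms*, Invent. Math. 94
  (1988), 529–573, §1 and Thm. 3. [Wiles1988]
* P. B. Allen, *Modularity of nearly ordinary 2-adic residually dihedral Galois representations*,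
  Compos. Math. 150 (2014), Lemma 87 (arXiv:1301.1113v2, §5.1.1, p. 70). [Allen2014]
* F. Diamond, J. Shurman, *A First Course in Modular Forms*, GTM 228 (2005), Prop. 5.2.2, 5.6.2.
  [DiamondShurman2005]
-/

noncomputable section

open scoped MatrixGroups ModularForm

open CongruenceSubgroup UpperHalfPlane

namespace Literature.NumberTheory.EllipticCurves.ModularForms

namespace WeightOneOrdinaryLift

/-! ### Norm bookkeeping in `ℚ̄_p` -/

section Norm

variable {p : ℕ} [Fact p.Prime]

/-- `‖x - y‖ ≤ max ‖x‖ ‖y‖`. [folklore] -/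
private theorem norm_sub_le_max (x y : PadicAlgCl p) : ‖x - y‖ ≤ max ‖x‖ ‖y‖ := by
  have h := PadicAlgCl.isNonarchimedean p x (-y)
  rwa [norm_neg, ← sub_eq_add_neg] at h

/-- `x ≡ y`, `y ≡ z ⟹ x ≡ z` modulo `𝔪`. [folklore] -/
private theorem norm_sub_lt_one_trans {x y z : PadicAlgCl p} (h₁ : ‖x - y‖ < 1) (h₂ : ‖y - z‖ < 1) :
    ‖x - z‖ < 1 := by
  have : x - z = (x - y) + (y - z) := by ring
  rw [this]
  exact (PadicAlgCl.isNonarchimedean p _ _).trans_lt (max_lt h₁ h₂)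

/-- A `p`-adic number congruent to a unit is a unit. [folklore] -/
theorem norm_eq_one_of_norm_sub_lt_one {x y : PadicAlgCl p} (hy : ‖y‖ = 1) (h : ‖x - y‖ < 1) :
    ‖x‖ = 1 := by
  have h1 : ‖x‖ ≤ 1 := by
    have : x = (x - y) + y := by ring
    rw [this]
    exact (PadicAlgCl.isNonarchimedean p _ _).trans (max_le h.le hy.le)
  rcases h1.lt_or_eq with hlt | heq
  · exfalso
    have : y = x - (x - y) := by ring
    have h2 : ‖y‖ < 1 := by
      rw [this]
      exact (norm_sub_le_max _ _).trans_lt (max_lt hlt h)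
    rw [hy] at h2
    exact lt_irrefl _ h2
  · exact heq

/-- `‖p‖ < 1` in `ℚ̄_p`. [folklore] -/
private theorem norm_natCast_prime_lt_one : ‖(p : PadicAlgCl p)‖ < 1 := by
  rw [← map_natCast (algebraMap ℚ_[p] (PadicAlgCl p)) p]
  change ‖((p : ℚ_[p]) : PadicAlgCl p)‖ < 1
  rw [PadicAlgCl.norm_extends]
  exact Padic.norm_p_lt_one

/-- A finite sum of elements of `𝔪` lies in `𝔪`. [folklore] -/
theorem norm_sum_lt_one {ι : Type*} (s : Finset ι) (u : ι → PadicAlgCl p)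
    (h : ∀ i ∈ s, ‖u i‖ < 1) : ‖∑ i ∈ s, u i‖ < 1 := by
  rcases s.eq_empty_or_nonempty with rfl | hs
  · rw [Finset.sum_empty, norm_zero]; exact zero_lt_one
  · obtain ⟨b, hb, hle⟩ :=
      IsNonarchimedean.finset_image_add_of_nonempty (PadicAlgCl.isNonarchimedean p) u hs
    exact hle.trans_lt (h b hb)

/-- A rational number of `p`-adic valuation `< 1` (an element of `p ℤ_{(p)}`) has norm `< 1` in
`ℚ̄_p`. [folklore] -/
theorem norm_ratCast_lt_one_of_padicValuation_lt_one (r : ℚ) (hr : Rat.padicValuation p r < 1) :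
    ‖(r : PadicAlgCl p)‖ < 1 := by
  have hp : p.Prime := Fact.out
  have hnum := (DeligneSerre1974.padicValuation_lt_one_iff_dvd_num r).mp hr
  have hden : ¬ p ∣ r.den := by
    intro h
    have h1 : p ∣ r.num.natAbs := Int.natCast_dvd.mp hnum
    have h2 : p ∣ r.num.natAbs.gcd r.den := Nat.dvd_gcd h1 h
    rw [r.reduced.gcd_eq_one] at h2
    exact hp.ne_one (Nat.dvd_one.mp h2)
  have h1 : ‖(r.num : PadicAlgCl p)‖ < 1 := by
    obtain ⟨t, ht⟩ := hnum
    rw [ht, Int.cast_mul, Int.cast_natCast, norm_mul]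
    exact mul_lt_one_of_nonneg_of_lt_one_left (norm_nonneg _) norm_natCast_prime_lt_one
      (DeligneSerreLift.norm_intCast_le_one t)
  rw [Rat.cast_def, norm_div,
    Literature.NumberTheory.GaloisRepresentations.PadicAlgCl.norm_natCast_of_not_dvd hden, div_one]
  exact h1

/-- **Fermat**: `q^w ≡ 1 (mod p)` for `p ∤ q` and `(p - 1) ∣ w`, read in `ℚ̄_p`. [folklore] -/
theorem norm_pow_sub_one_lt_one {q w : ℕ} (hq : ¬ p ∣ q) (hw : (p - 1) ∣ w) :
    ‖(q : PadicAlgCl p) ^ w - 1‖ < 1 := by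
  have hq0 : (q : ZMod p) ≠ 0 := by
    rw [Ne, ZMod.natCast_eq_zero_iff]
    exact hq
  have h1 : (q : ZMod p) ^ (p - 1) = 1 := ZMod.pow_card_sub_one_eq_one hq0
  obtain ⟨c, hc⟩ := hw
  have h2 : (((q : ℤ) ^ w - 1 : ℤ) : ZMod p) = 0 := by
    push_cast
    rw [hc, pow_mul, h1, one_pow, sub_self]
  obtain ⟨t, ht⟩ := (ZMod.intCast_zmod_eq_zero_iff_dvd _ p).mp h2
  have h3 : (q : PadicAlgCl p) ^ w - 1 = (((q : ℤ) ^ w - 1 : ℤ) : PadicAlgCl p) := by push_cast; ring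
  rw [h3, ht, Int.cast_mul, Int.cast_natCast, norm_mul]
  exact mul_lt_one_of_nonneg_of_lt_one_left (norm_nonneg _) norm_natCast_prime_lt_one
    (DeligneSerreLift.norm_intCast_le_one t)

/-- The values of a Dirichlet character have norm `≤ 1` through `ι⁻¹` (roots of unity at units,
`0` elsewhere). [folklore] -/
theorem norm_dirichletCharacter_le_one (ι : PadicAlgCl p ≃+* ℂ) {L : ℕ} [NeZero L]
    (ψ : DirichletCharacter ℂ L) (x : ZMod L) :
    ‖ι.symm (ψ x)‖ ≤ 1 ∧ (IsUnit x → ‖ι.symm (ψ x)‖ = 1) := by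
  by_cases hx : IsUnit x
  · obtain ⟨u, rfl⟩ := hx
    have h1 : ι.symm (ψ u) ^ Nat.totient L = 1 := by
      rw [← map_pow, ← map_pow, ← Units.val_pow_eq_pow_val, ZMod.pow_totient, Units.val_one,
        map_one, map_one]
    have h2 := Literature.NumberTheory.GaloisRepresentations.PadicAlgCl.norm_eq_one_of_pow_eq_one
      (Nat.totient_pos.mpr (NeZero.pos L)).ne' h1
    exact ⟨h2.le, fun _ ↦ h2⟩
  · rw [MulChar.map_nonunit ψ hx, map_zero, norm_zero]
    exact ⟨zero_le_one, fun h ↦ (hx h).elim⟩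

/-- A Dirichlet character has finite order: `ψ ^ φ(L) = 1`. [folklore] -/
theorem dirichletCharacter_pow_totient {L : ℕ} (ψ : DirichletCharacter ℂ L) :
    ψ ^ Nat.totient L = 1 := by
  refine MulChar.ext fun u ↦ ?_
  rw [MulChar.pow_apply_coe, MulChar.one_apply_coe, ← map_pow, ← Units.val_pow_eq_pow_val,
    ZMod.pow_totient, Units.val_one, map_one]

end Norm

/-! ### The Dirichlet character cut out by the diamond eigen-scalars of a non-zero form -/

section Character

variable {L : ℕ} [NeZero L] {k : ℤ}

/-- **The nebentypus of a diamond eigenvector.**  If `g ≠ 0` and `⟨d⟩ g = s(d) g` for every unit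
`d` modulo `L`, then `d ↦ s(d)` is a Dirichlet character `ψ` modulo `L` and `g ∈ S_k(L, ψ)`
(multiplicativity from `⟨d e⟩ = ⟨d⟩ ⟨e⟩`, `diamondOp_mul_holds`; non-vanishing from `⟨1⟩ = 1`).
[cite: DiamondShurman2005, §5.2 (p. 168)] -/
theorem exists_mem_nebentypusSubspace_of_diamondOp_eq_smul {g : CuspForm (Gamma1 L) k} (hg0 : g ≠ 0)
    {s : (ZMod L)ˣ → ℂ} (hs : ∀ d : (ZMod L)ˣ, diamondOp L k (d : ZMod L) g = s d • g) :
    ∃ ψ : DirichletCharacter ℂ L, (∀ d : (ZMod L)ˣ, ψ (d : ZMod L) = s d) ∧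
      g ∈ nebentypusSubspace L k ψ := by
  -- `s 1 = 1`, `s (d e) = s d * s e`, `s d ≠ 0`
  have hs1 : s 1 = 1 := by
    have h := hs 1
    rw [Units.val_one, Automorphic.ModularForms.diamondOp_one_apply] at h
    have h' : (1 : ℂ) • g = s 1 • g := by rw [one_smul]; exact h
    exact (smul_left_injective ℂ hg0 h').symm
  have hsmul : ∀ d e : (ZMod L)ˣ, s (d * e) = s d * s e := by
    intro d e
    have h := hs (d * e)
    rw [Units.val_mul, diamondOp_mul_holds L k d.isUnit e.isUnit, Module.End.mul_apply, hs e,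
      map_smul, hs d, smul_smul, mul_comm (s e)] at h
    exact (smul_left_injective ℂ hg0 h).symm
  have hs0 : ∀ d : (ZMod L)ˣ, s d ≠ 0 := by
    intro d h0
    have h := hsmul d d⁻¹
    rw [mul_inv_cancel, hs1, h0, zero_mul] at h
    exact one_ne_zero h
  let φ : (ZMod L)ˣ →* ℂˣ :=
    { toFun := fun d ↦ Units.mk0 (s d) (hs0 d)
      map_one' := Units.ext (by rw [Units.val_mk0, Units.val_one, hs1])
      map_mul' := fun d e ↦ Units.ext (by
        rw [Units.val_mul, Units.val_mk0, Units.val_mk0, Units.val_mk0, hsmul]) }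
  have hφ : ∀ d : (ZMod L)ˣ, MulChar.ofUnitHom φ (d : ZMod L) = s d := fun d ↦ by
    rw [MulChar.ofUnitHom_coe]; rfl
  refine ⟨MulChar.ofUnitHom φ, hφ, mem_nebentypusSubspace_iff_diamondOp.mpr fun d ↦ ?_⟩
  rw [hφ, hs d]

end Character

end WeightOneOrdinaryLift

/-! ### The theorem -/

section Main

open WeightOneOrdinaryLift DeligneSerre1974

variable {p : ℕ} [Fact p.Prime] {N : ℕ} [NeZero N]

set_option maxHeartbeats 3200000 in
/-- **A `p`-ordinary newform of weight `≥ 2` congruent to the `p`-stabilisation of a weight-one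
eigenform of level prime to `p`** (Deligne–Serre 1974, 6.9–6.11, with `U_p` in the Hecke family;
the classical form of Wiles 1988, Thm. 3 + specialisation, as used in Allen 2014, Lemma 87).  See the
module docstring for the statement and the proof.
[cite: DeligneSerreASENS1974, 6.9–6.11] [cite: Wiles1988, §1 and Thm. 3] [cite: Allen2014, Lemma 87 (p. 70)] -/
theorem exists_ordinary_newform_congr_of_weight_one (ι : PadicAlgCl p ≃+* ℂ) (hpN : ¬ p ∣ N)
    {χ : DirichletCharacter ℂ N} {f : CuspForm (Gamma1 N) 1} (hfχ : f ∈ nebentypusSubspace N 1 χ)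
    (hf1 : cuspCoeff f 1 = 1) (hint : ∀ n, ‖ι.symm (cuspCoeff f n)‖ ≤ 1)
    {a : ℕ → ℂ}
    (hT : ∀ (q : ℕ) (hq : q.Prime), ¬ q ∣ N →
      (haveI : NeZero q := ⟨hq.ne_zero⟩; heckeT (Gamma1 N) 1 q f) = a q • f)
    {α β : ℂ} (hαβ : α + β = a p) (hαβ' : α * β = χ p) (hα : ‖ι.symm α‖ = 1)
    (hβ : ‖ι.symm β‖ ≤ 1) :
    ∃ (k : ℤ) (L₀ : ℕ) (_ : NeZero L₀) (_ : L₀ ∣ N * p) (g₀ : CuspForm (Gamma1 L₀) k),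
      2 ≤ k ∧ ((p : ℤ) - 1 ∣ k - 1) ∧ IsNewform1 g₀ ∧
      ‖ι.symm (cuspCoeff g₀ p) - ι.symm α‖ < 1 ∧
      (∀ q : ℕ, q.Prime → ¬ q ∣ N * p → ‖ι.symm (cuspCoeff g₀ q) - ι.symm (a q)‖ < 1) ∧
      (∀ q : ℕ, q.Prime → ¬ q ∣ N * p →
        ‖ι.symm (nebentypus g₀ (q : ZMod L₀) * (q : ℂ) ^ (k - 1)) - ι.symm (χ q)‖ < 1) := by
  classical
  have hp : p.Prime := Fact.out
  haveI : NeZero p := ⟨hp.ne_zero⟩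
  have hpL : p ∣ N * p := dvd_mul_left p N
  have hNL : N ∣ N * p := dvd_mul_right N p
  have h1N := HeckeTGamma1.one_mem_strictPeriods_Gamma1 N
  have h1L := HeckeTGamma1.one_mem_strictPeriods_Gamma1 (N * p)
  set χ' : DirichletCharacter ℂ (N * p) := DirichletCharacter.changeLevel hNL χ with hχ'
  -- values of `χ`, `χ'` at good primes, and their norms
  have hχ'q : ∀ q : ℕ, q.Prime → ¬ q ∣ N * p → χ' (q : ZMod (N * p)) = χ (q : ZMod N) := by
    intro q hq hqL
    have hcopZ : IsCoprime (q : ℤ) ((N * p : ℕ) : ℤ) :=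
      Nat.isCoprime_iff_coprime.2 ((Nat.Prime.coprime_iff_not_dvd hq).2 hqL)
    have h := DirichletCharacter.changeLevel_eq_cast_of_dvd' χ hNL hcopZ
    simpa only [Int.cast_natCast] using h
  have hnχ : ∀ x : ZMod N, ‖ι.symm (χ x)‖ ≤ 1 := fun x ↦ (norm_dirichletCharacter_le_one ι χ x).1
  have hnχ' : ∀ x : ZMod (N * p), ‖ι.symm (χ' x)‖ ≤ 1 := fun x ↦
    (norm_dirichletCharacter_le_one ι χ' x).1
  -- `‖ι⁻¹ a_q‖ ≤ 1` for `q ∤ N`: `a_q = a_q(f)` in weight one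
  have haq : ∀ (q : ℕ) (hq : q.Prime), ¬ q ∣ N → a q = cuspCoeff f q := by
    intro q hq hqN
    haveI : NeZero q := ⟨hq.ne_zero⟩
    have h1 : cuspCoeff (heckeT (Gamma1 N) 1 q f) 1 = a q := by
      rw [hT q hq hqN, cuspCoeff_smul_gamma1, hf1, mul_one]
    rw [← h1, cuspCoeff_heckeT_gamma1 f q hq 1, mul_one, if_neg hqN, if_neg hq.not_dvd_one,
      mul_zero, add_zero]
  have hna : ∀ (q : ℕ), q.Prime → ¬ q ∣ N → ‖ι.symm (a q)‖ ≤ 1 := fun q hq hqN ↦ by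
    rw [haq q hq hqN]; exact hint q
  -- ### Step 1: the `p`-stabilisation `F ∈ S_1(Np, χ')`
  have hαβ'' : α * β = χ p * (p : ℂ) ^ ((1 : ℤ) - 1) := by
    rw [sub_self, zpow_zero, mul_one]; exact hαβ'
  obtain ⟨F, hFχ, hFU, hFT, hFcoeff⟩ := exists_pStabilised hp hpN hfχ (hT p hp hpN) hαβ hαβ''
  -- its coefficients: `p`-integral, `a_1(F) = 1`, `a_{pn}(F) = α a_n(F)`, Hecke relations
  have hbint : ∀ n, ‖ι.symm (cuspCoeff F n)‖ ≤ 1 := by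
    intro n
    rw [hFcoeff n, map_sub, map_mul]
    refine (norm_sub_le_max _ _).trans (max_le (hint n) ?_)
    rw [norm_mul]
    refine mul_le_one₀ hβ (norm_nonneg _) ?_
    split_ifs
    · exact hint _
    · rw [map_zero, norm_zero]; exact zero_le_one
  have hb1 : cuspCoeff F 1 = 1 := by
    rw [hFcoeff 1, if_neg hp.not_dvd_one, mul_zero, sub_zero, hf1]
  have hbU : ∀ n, cuspCoeff F (p * n) = α * cuspCoeff F n := by
    intro n
    have h := congrArg (fun G ↦ cuspCoeff G n) hFU
    simp only [cuspCoeff_smul_gamma1, cuspCoeff_heckeT_gamma1 F p hp n, if_pos hpL, add_zero] at h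
    exact h
  have hbT : ∀ (q : ℕ) (hq : q.Prime), ¬ q ∣ N * p → ∀ n,
      cuspCoeff F (q * n) + χ' q * (if q ∣ n then cuspCoeff F (n / q) else 0) =
        a q * cuspCoeff F n := by
    intro q hq hqL n
    haveI : NeZero q := ⟨hq.ne_zero⟩
    have hqN : ¬ q ∣ N := fun h ↦ hqL (h.trans hNL)
    have hqp : q ≠ p := fun h ↦ hqL (h ▸ hpL)
    have hunit : IsUnit ((q : ℕ) : ZMod (N * p)) := (ZMod.isUnit_prime_iff_not_dvd hq).mpr hqL
    have h := congrArg (fun G ↦ cuspCoeff G n) (hFT q hq hqp (a q) (hT q hq hqN))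
    simp only [cuspCoeff_smul_gamma1, cuspCoeff_heckeT_gamma1 F q hq n, if_neg hqL, sub_self,
      zpow_zero, one_mul] at h
    rw [← h]
    congr 1
    by_cases hqn : q ∣ n
    · rw [if_pos hqn, if_pos hqn, cuspCoeff_diamondOp_of_mem_nebentypusSubspace hFχ hunit]
    · rw [if_neg hqn, if_neg hqn, mul_zero]
  -- ### Step 2: the Eisenstein series `E_w ≡ 1 (mod p)` and `G = F E_w ∈ S_{1+w}(Np, χ')`
  obtain ⟨w, hw3, hwev, hpw⟩ := exists_eisenstein_weight hp
  set E := ModularForm.E hw3 with hEdef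
  obtain ⟨hE0, hEm⟩ := eisenstein_qExpansion_congr_one (ℓ := p) hw3 hwev hpw
  set k : ℤ := 1 + (w : ℤ) with hkdef
  have hk1 : (1 : ℤ) ≤ k := by omega
  have hk2 : (2 : ℤ) ≤ k := by omega
  have hw0 : w ≠ 0 := by omega
  let G : CuspForm (Gamma1 (N * p)) k := F.mulModularForm (ofLevelOne (Gamma1 (N * p)) E)
  have hGq : qExpansion 1 ⇑G = qExpansion 1 ⇑F * qExpansion 1 ⇑E :=
    qExpansion_mulModularForm_ofLevelOne E F
  -- `e_j ∈ 𝔪` for `j ≠ 0`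
  have hEj : ∀ j, j ≠ 0 → ‖ι.symm ((qExpansion 1 ⇑E).coeff j)‖ < 1 := by
    intro j hj
    obtain ⟨r, hr, hrj⟩ := hEm j hj
    rw [hrj, map_ratCast]
    exact norm_ratCast_lt_one_of_padicValuation_lt_one r hr
  -- `a_n(G) ≡ a_n(F) (mod 𝔪)`
  have hcb : ∀ n, ‖ι.symm (cuspCoeff G n) - ι.symm (cuspCoeff F n)‖ < 1 := by
    intro n
    have hmul : cuspCoeff G n = ∑ ij ∈ Finset.HasAntidiagonal.antidiagonal n,
        cuspCoeff F ij.1 * (qExpansion 1 ⇑E).coeff ij.2 := by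
      change (qExpansion 1 ⇑G).coeff n = _
      rw [hGq, PowerSeries.coeff_mul]
      rfl
    have hmem : (n, 0) ∈ Finset.HasAntidiagonal.antidiagonal n := by simp
    rw [hmul, ← Finset.add_sum_erase _ _ hmem, hE0, mul_one, map_add, add_sub_cancel_left, map_sum]
    refine norm_sum_lt_one _ _ fun ij hij ↦ ?_
    obtain ⟨hne, hij'⟩ := Finset.mem_erase.mp hij
    have hj : ij.2 ≠ 0 := by
      intro h
      apply hne
      have := Finset.HasAntidiagonal.mem_antidiagonal.mp hij'
      rw [h, add_zero] at this
      exact Prod.ext this h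
    rw [map_mul, norm_mul]
    exact mul_lt_one_of_nonneg_of_lt_one_right (hbint _) (norm_nonneg _) (hEj _ hj)
  have hcint : ∀ n, ‖ι.symm (cuspCoeff G n)‖ ≤ 1 := fun n ↦ by
    have : ι.symm (cuspCoeff G n) =
        (ι.symm (cuspCoeff G n) - ι.symm (cuspCoeff F n)) + ι.symm (cuspCoeff F n) := by ring
    rw [this]
    exact (PadicAlgCl.isNonarchimedean p _ _).trans (max_le (hcb n).le (hbint n))
  have hc1 : ‖ι.symm (cuspCoeff G 1)‖ = 1 := by
    refine norm_eq_one_of_norm_sub_lt_one (y := ι.symm (cuspCoeff F 1)) ?_ (hcb 1)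
    rw [hb1, map_one, norm_one]
  -- `G ∈ S_k(Np, χ')`
  have hFd : ∀ d : (ZMod (N * p))ˣ, diamondOp (N * p) 1 (d : ZMod (N * p)) F = χ' d • F :=
    mem_nebentypusSubspace_iff_diamondOp.mp hFχ
  have hGχ : G ∈ nebentypusSubspace (N * p) k χ' := by
    rw [mem_nebentypusSubspace_iff_diamondOp]
    intro d
    change diamondOp (N * p) (1 + (w : ℤ)) d (F.mulModularForm (ofLevelOne (Gamma1 (N * p)) E)) = _
    rw [diamondOp_mulModularForm_ofLevelOne E (d : ZMod (N * p)) F, hFd d, smul_mulModularForm]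
  -- ### Step 3: `G` is an eigenvector modulo `𝔪` of the `T_q` (`q ∤ Np`) and of `U_p`
  have hcongT : ∀ (q : ℕ) (hq : q.Prime), ¬ q ∣ N * p → ∀ n,
      ‖ι.symm (cuspCoeff ((haveI : NeZero q := ⟨hq.ne_zero⟩; heckeT (Gamma1 (N * p)) k q) G) n) -
        ι.symm (a q) * ι.symm (cuspCoeff G n)‖ < 1 := by
    intro q hq hqL n
    haveI : NeZero q := ⟨hq.ne_zero⟩
    have hqN : ¬ q ∣ N := fun h ↦ hqL (h.trans hNL)
    have hpq : ¬ p ∣ q := fun h ↦ hqL (((Nat.prime_dvd_prime_iff_eq hp hq).mp h) ▸ hpL)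
    have hunit : IsUnit ((q : ℕ) : ZMod (N * p)) := (ZMod.isUnit_prime_iff_not_dvd hq).mpr hqL
    have hzpow : ((q : ℂ)) ^ (k - 1) = (q : ℂ) ^ w := by
      rw [hkdef, show (1 : ℤ) + (w : ℤ) - 1 = ((w : ℕ) : ℤ) by omega, zpow_natCast]
    have hTG := cuspCoeff_heckeT_gamma1 G q hq n
    rw [if_neg hqL, hzpow] at hTG
    have hrel := hbT q hq hqL n
    have e1 : ‖ι.symm (cuspCoeff G (q * n) - cuspCoeff F (q * n))‖ < 1 := by
      rw [map_sub]; exact hcb _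
    have e4 : ‖ι.symm (a q * (cuspCoeff G n - cuspCoeff F n))‖ < 1 := by
      rw [map_mul, norm_mul, map_sub]
      exact mul_lt_one_of_nonneg_of_lt_one_right (hna q hq hqN) (norm_nonneg _) (hcb n)
    by_cases hqn : q ∣ n
    · rw [if_pos hqn, cuspCoeff_diamondOp_of_mem_nebentypusSubspace hGχ hunit] at hTG
      rw [if_pos hqn] at hrel
      rw [hTG]
      have key : cuspCoeff G (q * n) + (q : ℂ) ^ w * (χ' q * cuspCoeff G (n / q)) -
          a q * cuspCoeff G n =
          (cuspCoeff G (q * n) - cuspCoeff F (q * n)) +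
            χ' q * ((q : ℂ) ^ w - 1) * cuspCoeff G (n / q) +
            χ' q * (cuspCoeff G (n / q) - cuspCoeff F (n / q)) -
            a q * (cuspCoeff G n - cuspCoeff F n) := by
        linear_combination hrel
      rw [← map_mul, ← map_sub, key, map_sub, map_add, map_add]
      have e2 : ‖ι.symm (χ' q * ((q : ℂ) ^ w - 1) * cuspCoeff G (n / q))‖ < 1 := by
        rw [map_mul, map_mul, norm_mul, norm_mul, map_sub, map_pow ι.symm, map_natCast ι.symm,
          map_one]
        exact mul_lt_one_of_nonneg_of_lt_one_left (mul_nonneg (norm_nonneg _) (norm_nonneg _))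
          (mul_lt_one_of_nonneg_of_lt_one_right (hnχ' _) (norm_nonneg _)
            (norm_pow_sub_one_lt_one hpq hpw)) (hcint _)
      have e3 : ‖ι.symm (χ' q * (cuspCoeff G (n / q) - cuspCoeff F (n / q)))‖ < 1 := by
        rw [map_mul, norm_mul, map_sub]
        exact mul_lt_one_of_nonneg_of_lt_one_right (hnχ' _) (norm_nonneg _) (hcb _)
      refine (norm_sub_le_max _ _).trans_lt (max_lt ?_ e4)
      refine (PadicAlgCl.isNonarchimedean p _ _).trans_lt (max_lt ?_ e3)
      exact (PadicAlgCl.isNonarchimedean p _ _).trans_lt (max_lt e1 e2)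
    · rw [if_neg hqn, mul_zero, add_zero] at hTG
      rw [if_neg hqn, mul_zero, add_zero] at hrel
      rw [hTG]
      have key : cuspCoeff G (q * n) - a q * cuspCoeff G n =
          (cuspCoeff G (q * n) - cuspCoeff F (q * n)) - a q * (cuspCoeff G n - cuspCoeff F n) := by
        linear_combination hrel
      rw [← map_mul, ← map_sub, key, map_sub]
      exact (norm_sub_le_max _ _).trans_lt (max_lt e1 e4)
  have hcongU : ∀ n, ‖ι.symm (cuspCoeff (heckeT (Gamma1 (N * p)) k p G) n) -
      ι.symm α * ι.symm (cuspCoeff G n)‖ < 1 := by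
    intro n
    rw [cuspCoeff_heckeT_gamma1 G p hp n, if_pos hpL, add_zero]
    have key : cuspCoeff G (p * n) - α * cuspCoeff G n =
        (cuspCoeff G (p * n) - cuspCoeff F (p * n)) - α * (cuspCoeff G n - cuspCoeff F n) := by
      rw [hbU n]; ring
    rw [← map_mul, ← map_sub, key, map_sub, map_mul, map_sub, map_sub]
    refine (norm_sub_le_max _ _).trans_lt (max_lt (hcb (p * n)) ?_)
    rw [norm_mul, hα, one_mul]
    exact hcb n
  -- ### Step 4: Deligne–Serre lifting in `S_k(Np, χ')` with the family `{T_q : q ∤ Np} ∪ {U_p}`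
  let TL : ℕ → Module.End ℂ (CuspForm (Gamma1 (N * p)) k) := fun q ↦
    if hq : q = 0 then 0 else (haveI : NeZero q := ⟨hq⟩; heckeT (Gamma1 (N * p)) k q)
  have hTL : ∀ (q : ℕ) (hq : q ≠ 0),
      TL q = (haveI : NeZero q := ⟨hq⟩; heckeT (Gamma1 (N * p)) k q) := fun q hq ↦ dif_neg hq
  have hTLp : TL p = heckeT (Gamma1 (N * p)) k p := hTL p hp.ne_zero
  let 𝒯 : Set (Module.End ℂ (CuspForm (Gamma1 (N * p)) k)) :=
    {T | ∃ q : ℕ, (q.Prime ∧ ¬ q ∣ N * p ∨ q = p) ∧ T = TL q}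
  have h𝒯 : ∀ T ∈ 𝒯, ∃ q : ℕ, q.Prime ∧ T = TL q := by
    rintro T ⟨q, hq, rfl⟩
    rcases hq with hq | hq
    · exact ⟨q, hq.1, rfl⟩
    · exact ⟨q, hq ▸ hp, rfl⟩
  have hcomm : ∀ S ∈ 𝒯, ∀ T ∈ 𝒯, Commute S T := by
    intro S hS T hT'
    obtain ⟨q, hq, rfl⟩ := h𝒯 S hS
    obtain ⟨q', hq', rfl⟩ := h𝒯 T hT'
    rw [hTL q hq.ne_zero, hTL q' hq'.ne_zero]
    haveI : NeZero q := ⟨hq.ne_zero⟩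
    haveI : NeZero q' := ⟨hq'.ne_zero⟩
    exact heckeT_comm_holds (N * p) k q q'
  have hdiam : ∀ T ∈ 𝒯, ∀ d : (ZMod (N * p))ˣ,
      Commute T (diamondOp (N * p) k (d : ZMod (N * p))) := by
    intro T hT' d
    obtain ⟨q, hq, rfl⟩ := h𝒯 T hT'
    rw [hTL q hq.ne_zero]
    haveI : NeZero q := ⟨hq.ne_zero⟩
    exact heckeT_diamondOp_comm_holds (N * p) k q (d : ZMod (N * p))
  have hΛ : ∀ T ∈ 𝒯, ∀ x ∈ integralLattice1 (N * p) k, T x ∈ integralLattice1 (N * p) k := by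
    intro T hT' x hx
    obtain ⟨q, hq, rfl⟩ := h𝒯 T hT'
    rw [hTL q hq.ne_zero]
    haveI : NeZero q := ⟨hq.ne_zero⟩
    exact heckeT_mem_integralLattice1 hk1 hx q hq
  -- the targets: any admissible congruence class (unique modulo `𝔪`)
  let P : Module.End ℂ (CuspForm (Gamma1 (N * p)) k) → PadicAlgCl p → Prop := fun T t ↦
    ‖t‖ ≤ 1 ∧ ∀ n, ‖ι.symm (cuspCoeff (T G) n) - t * ι.symm (cuspCoeff G n)‖ < 1
  let tg : Module.End ℂ (CuspForm (Gamma1 (N * p)) k) → PadicAlgCl p := fun T ↦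
    if h : ∃ t, P T t then h.choose else 0
  have htgP : ∀ T t, P T t → P T (tg T) := by
    intro T t ht
    have h : ∃ t, P T t := ⟨t, ht⟩
    simp only [tg, dif_pos h]
    exact h.choose_spec
  have hPuniq : ∀ T t₁ t₂, P T t₁ → P T t₂ → ‖t₁ - t₂‖ < 1 := by
    intro T t₁ t₂ h₁ h₂
    have h := norm_sub_lt_one_trans (by rw [← norm_neg, neg_sub]; exact h₁.2 1) (h₂.2 1)
    rw [← sub_mul, norm_mul, hc1, mul_one] at h
    exact h
  have hPT : ∀ (q : ℕ) (hq : q.Prime), ¬ q ∣ N * p → P (TL q) (ι.symm (a q)) := by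
    intro q hq hqL
    refine ⟨hna q hq fun h ↦ hqL (h.trans hNL), fun n ↦ ?_⟩
    rw [hTL q hq.ne_zero]
    exact hcongT q hq hqL n
  have hPU : P (TL p) (ι.symm α) := ⟨hα.le, fun n ↦ by rw [hTLp]; exact hcongU n⟩
  have htg : ∀ T ∈ 𝒯, ‖tg T‖ ≤ 1 := by
    intro T _
    by_cases h : ∃ t, P T t
    · exact (htgP T _ h.choose_spec).1
    · simp only [tg, dif_neg h, norm_zero]; exact zero_le_one
  have hcongr : ∀ T ∈ 𝒯, ∀ n,
      ‖ι.symm (cuspCoeff (T G) n) - tg T * ι.symm (cuspCoeff G n)‖ < 1 := by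
    rintro T ⟨q, hq, rfl⟩ n
    rcases hq with hq | hq
    · exact (htgP _ _ (hPT q hq.1 hq.2)).2 n
    · rw [hq]; exact (htgP _ _ hPU).2 n
  have hχ'm : χ' ^ Nat.totient (N * p) = 1 := dirichletCharacter_pow_totient χ'
  have hm0 : Nat.totient (N * p) ≠ 0 := (Nat.totient_pos.mpr (NeZero.pos (N * p))).ne'
  obtain ⟨g₁, a', hg₁0, hg₁d, hTg⟩ :=
    DeligneSerreLift.exists_eigenform_of_congruence_nebentypus_congr ι hk1 hm0 hχ'm 𝒯 hcomm hdiam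
      hΛ tg htg hGχ hcint hc1 hcongr
  -- ### Step 5: the eigenvalues of `g₁`
  have hmemT : ∀ (q : ℕ), q.Prime → ¬ q ∣ N * p → TL q ∈ 𝒯 := fun q hq hqL ↦
    ⟨q, Or.inl ⟨hq, hqL⟩, rfl⟩
  have hmemU : TL p ∈ 𝒯 := ⟨p, Or.inr rfl, rfl⟩
  have ha'T : ∀ (q : ℕ), q.Prime → ¬ q ∣ N * p → ‖a' (TL q) - ι.symm (a q)‖ < 1 := by
    intro q hq hqL
    exact norm_sub_lt_one_trans (hTg _ (hmemT q hq hqL)).2.1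
      (hPuniq _ _ _ (htgP _ _ (hPT q hq hqL)) (hPT q hq hqL))
  have ha'U : ‖a' (TL p) - ι.symm α‖ < 1 :=
    norm_sub_lt_one_trans (hTg _ hmemU).2.1 (hPuniq _ _ _ (htgP _ _ hPU) hPU)
  have hna'U : ‖a' (TL p)‖ = 1 := norm_eq_one_of_norm_sub_lt_one hα ha'U
  have hμ0 : ι (a' (TL p)) ≠ 0 := by
    intro h0
    have h1 : a' (TL p) = 0 := by
      have := congrArg ι.symm h0
      rwa [RingEquiv.symm_apply_apply, map_zero] at this
    rw [h1, norm_zero] at hna'U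
    exact zero_ne_one hna'U
  have hU : heckeT (Gamma1 (N * p)) k p g₁ = ι (a' (TL p)) • g₁ := by
    rw [← hTLp]; exact (hTg _ hmemU).2.2
  have hTg₁ : ∀ (q : ℕ) (hq : q.Prime), ¬ q ∣ N * p →
      (haveI : NeZero q := ⟨hq.ne_zero⟩; heckeT (Gamma1 (N * p)) k q) g₁ = ι (a' (TL q)) • g₁ := by
    intro q hq hqL
    rw [← hTL q hq.ne_zero]
    exact (hTg _ (hmemT q hq hqL)).2.2
  -- the nebentypus of `g₁`: the character `ψ` of the diamond eigen-scalars
  choose cd hcd1 hcdm hcdχ hcdd using hg₁d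
  obtain ⟨ψ, hψ, hg₁ψ⟩ := exists_mem_nebentypusSubspace_of_diamondOp_eq_smul hg₁0
    (s := fun d ↦ ι (cd d)) hcdd
  -- ### Step 6: the newform behind `g₁`
  obtain ⟨L₀, hL₀0, hL₀, g₀, hg₀, hg₀q, hg₀ψ, hg₀p⟩ :=
    exists_isNewform1_of_eigenpacket_of_heckeT_prime hp hpN hg₁0 hg₁ψ (a := fun q ↦ ι (a' (TL q)))
      hTg₁ hU
  refine ⟨k, L₀, hL₀0, hL₀, g₀, hk2, ?_, hg₀, ?_, fun q hq hqL ↦ ?_, fun q hq hqL ↦ ?_⟩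
  · -- `(p - 1) ∣ (k - 1) = w`
    rw [hkdef, show (1 : ℤ) + (w : ℤ) - 1 = (w : ℤ) by ring]
    obtain ⟨e, he⟩ := hpw
    refine ⟨e, ?_⟩
    rw [he, Nat.cast_mul, Nat.cast_sub hp.one_le, Nat.cast_one]
  · -- `a_p(g₀) ≡ α`
    refine norm_sub_lt_one_trans ?_ ha'U
    rcases hg₀p with ⟨-, hgp⟩ | ⟨-, hgp⟩
    · rw [hgp, RingEquiv.symm_apply_apply, sub_self, norm_zero]
      exact zero_lt_one
    · -- `a_p(g₀) = μ + ε(p) p^{k-1} / μ`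
      have hzpow : ((p : ℂ)) ^ (k - 1) = (p : ℂ) ^ w := by
        rw [hkdef, show (1 : ℤ) + (w : ℤ) - 1 = ((w : ℕ) : ℤ) by omega, zpow_natCast]
      rw [hzpow] at hgp
      set μ : ℂ := ι (a' (TL p)) with hμ_def
      have h1 : cuspCoeff g₀ p * μ = μ * μ + nebentypus g₀ (p : ZMod L₀) * (p : ℂ) ^ w := by
        linear_combination -hgp
      have hap : cuspCoeff g₀ p = μ + nebentypus g₀ (p : ZMod L₀) * (p : ℂ) ^ w * μ⁻¹ := by
        calc cuspCoeff g₀ p = (cuspCoeff g₀ p * μ) * μ⁻¹ := by rw [mul_inv_cancel_right₀ hμ0]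
          _ = (μ * μ + nebentypus g₀ (p : ZMod L₀) * (p : ℂ) ^ w) * μ⁻¹ := by rw [h1]
          _ = μ + nebentypus g₀ (p : ZMod L₀) * (p : ℂ) ^ w * μ⁻¹ := by
            rw [add_mul, mul_inv_cancel_right₀ hμ0]
      rw [hap, map_add, map_mul, map_mul, map_inv₀, hμ_def, RingEquiv.symm_apply_apply,
        add_sub_cancel_left, norm_mul, norm_mul, norm_inv, hna'U, inv_one, mul_one, map_pow ι.symm,
        map_natCast ι.symm, norm_pow]
      exact mul_lt_one_of_nonneg_of_lt_one_right (norm_dirichletCharacter_le_one ι _ _).1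
        (pow_nonneg (norm_nonneg _) _) (pow_lt_one₀ (norm_nonneg _) norm_natCast_prime_lt_one hw0)
  · -- `a_q(g₀) ≡ a_q`
    simp only [hg₀q q hq hqL, RingEquiv.symm_apply_apply]
    exact ha'T q hq hqL
  · -- `ε_{g₀}(q) q^{k-1} ≡ χ(q)`
    have hpq : ¬ p ∣ q := fun h ↦ hqL (((Nat.prime_dvd_prime_iff_eq hp hq).mp h) ▸ hpL)
    have hcopZ : IsCoprime (q : ℤ) ((N * p : ℕ) : ℤ) :=
      Nat.isCoprime_iff_coprime.2 ((Nat.Prime.coprime_iff_not_dvd hq).2 hqL)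
    obtain ⟨u, hu⟩ := (ZMod.isUnit_prime_iff_not_dvd hq).mpr hqL
    have hε : nebentypus g₀ (q : ZMod L₀) = ι (cd u) := by
      have h := DirichletCharacter.changeLevel_eq_cast_of_dvd' (nebentypus g₀) hL₀ hcopZ
      simp only [Int.cast_natCast] at h
      rw [← h, hg₀ψ, ← hu]
      exact hψ u
    have hzpow : ((q : ℂ)) ^ (k - 1) = (q : ℂ) ^ w := by
      rw [hkdef, show (1 : ℤ) + (w : ℤ) - 1 = ((w : ℕ) : ℤ) by omega, zpow_natCast]
    have hχu : χ (q : ZMod N) = χ' u := by rw [hu, hχ'q q hq hqL]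
    rw [hε, hzpow, hχu, map_mul, RingEquiv.symm_apply_apply, map_pow ι.symm, map_natCast ι.symm]
    have key : cd u * (q : PadicAlgCl p) ^ w - ι.symm (χ' u) =
        cd u * ((q : PadicAlgCl p) ^ w - 1) + (cd u - ι.symm (χ' u)) := by ring
    rw [key]
    refine (PadicAlgCl.isNonarchimedean p _ _).trans_lt (max_lt ?_ (hcdχ u))
    rw [norm_mul]
    exact mul_lt_one_of_nonneg_of_lt_one_right (hcd1 u) (norm_nonneg _)
      (norm_pow_sub_one_lt_one hpq hpw)

end Main

end Literature.NumberTheory.EllipticCurves.ModularForms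

end
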